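import Mathlib
import Literature.Analysis.FluidPDE.VectorCalculus
import Literature.Analysis.FluidPDE.RadialCalculus
import Literature.Analysis.PDE.LoewnerNirenberg
import Summits.NavierStokesRegularity.NavierStokesRegularity.Theorems.UnthreadedDoorKinematicShadowPointSourceCalculus
import Summits.NavierStokesRegularity.NavierStokesRegularity.Theorems.UnthreadedDoorFluxStarvedDipoleAmplitudeInequality
import HarnessLib

/-!
# Route `UnthreadedDoor`, crux `PoloidalLiouville` (stmt-NavierStokesRegularity-1222), wall W1 — crux idea
# «flux-starved-dipoles» (ns-idea-15 g12/g13, `Cruxes/PoloidalLiouville/FluxStarvedDipoleSketch.lean`):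
# calculus of the TURNING-AXIS DIPOLE POTENTIAL `T(x) = ⟪A(‖x−x₀‖), x−x₀⟫/‖x−x₀‖ + R(‖x−x₀‖)`

First of two support files for the PDE half of the sketch Prop `AmplitudeLawSteady` (K1 `DipoleNeverSteady` is composed in the
sketch as `AmplitudeLawSteady → ConvexEndgame → DipoleNeverSteady`; `ConvexEndgame` is p836018, the ODE half of
`AmplitudeLawSteady` is p836154 `amplitude_law_of_poleIdentity`).  The sequel `…FluxStarvedDipolePoleIdentity` proves the POLE
IDENTITY `⟪A″ + (2/r)A′ − (2/r²)A, A⟫(r) = 0` from the steady kinematic law and shell tangency; this file supplies the calculus of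
the dipole potential (`A, R ∈ C³(0,∞)`; the potential is passed as `T` with the defining equation `hT`, so that the statements
apply verbatim to the sketch's `dipolePotential x₀ A R`):

* `dipole_contDiffAt`, `dipole_differentiableAt_gradient`, `dipole_differentiableAt_laplacian` — `T ∈ C³` off the centre,
  so `∇T` and `ΔT` are differentiable there;
* `dipole_fderiv_apply_eq_zero` — `DT(p)[w] = 0` for `w ⊥ p − x₀` and `w ⊥ A(‖p − x₀‖)` (at the poles `p = x₀ ± rÂ(r)`:
  every tangent direction), by differentiating along the line `p + tw` (`hasDerivAt_norm_line`);
* `profile_calculus` — the `σ = ρ² ↔ ρ` conversion: the profile `P(σ) = ⟪A(√σ), e⟫/√σ` of the FIXED-axis potential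
  `⟪e, y⟫P(‖y‖²)` has the derivative data of `KinematicShadow.PointSource.laplacian_potential` at `σ = r²`, with
  `4r²P″ + 10P′ = (⟪A″,e⟫ + (2/r)⟪A′,e⟫ − (2/r²)⟪A,e⟫)/r`; `radial_calculus` — the same for `R(√σ)`;
* `dipole_frame_expansion`, `dipole_laplacian_sphere` — in an orthonormal frame `b` the potential is the sum of three
  fixed-axis potentials plus a radial function, hence on the sphere `‖y‖ = r`:
  `ΔT(x₀ + y) = Σᵢ ⟪bᵢ, y⟫·Cᵢ + D`, `Cᵢ = (⟪A″,bᵢ⟫ + (2/r)⟪A′,bᵢ⟫ − (2/r²)⟪A,bᵢ⟫)(r)/r`.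

HONEST LABEL: multivariable calculus in the LINEAR kinematic shadow of W1 (critic V28: information-grade, W1 movement 0);
`AmplitudeLawSteady`, `FluxStarvationSteady`, K1, `PoloidalLiouville` (1222), its wall `stub_scalarLiouville` and the summit stay
OPEN; NO Navier–Stokes regularity statement is proved.  `--supports stmt-NavierStokesRegularity-1222` (helper).  [folklore]
-/

noncomputable section

-- the summit and its single sub-problem share the name (CONVENTIONS §1)
set_option linter.dupNamespace false

open Set Filter Topology InnerProductSpace
open scoped RealInnerProductSpace Laplacian
open Literature.Analysis.FluidPDE

namespace Summit.NavierStokesRegularity.NavierStokesRegularity.Theorems.PoloidalLiouville.FluxStarvedDipole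

/-! ### Regularity of the dipole potential off the centre -/

/-- The turning-axis dipole potential `T(x) = ⟪A(‖x−x₀‖), x−x₀⟫/‖x−x₀‖ + R(‖x−x₀‖)` is `C³` off the centre when
`A, R ∈ C³(0,∞)`. [folklore] -/
theorem dipole_contDiffAt {A : ℝ → (EuclideanSpace ℝ (Fin 3))} {R : ℝ → ℝ} {x₀ x : (EuclideanSpace ℝ (Fin 3))} {T : (EuclideanSpace ℝ (Fin 3)) → ℝ}
    (hT : ∀ z, T z = ⟪A ‖z - x₀‖, z - x₀⟫ / ‖z - x₀‖ + R ‖z - x₀‖)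
    (hA : ContDiffOn ℝ 3 A (Ioi 0)) (hR : ContDiffOn ℝ 3 R (Ioi 0)) (hx : x ≠ x₀) :
    ContDiffAt ℝ 3 T x := by
  have hfun : T = fun z => ⟪A ‖z - x₀‖, z - x₀⟫ / ‖z - x₀‖ + R ‖z - x₀‖ := funext hT
  have hsub : ContDiffAt ℝ 3 (fun z : (EuclideanSpace ℝ (Fin 3)) => z - x₀) x := contDiffAt_id.sub contDiffAt_const
  have hne : x - x₀ ≠ 0 := sub_ne_zero.mpr hx
  have hn : ContDiffAt ℝ 3 (fun z : (EuclideanSpace ℝ (Fin 3)) => ‖z - x₀‖) x := hsub.norm ℝ hne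
  have hpos : ‖x - x₀‖ ∈ Ioi (0 : ℝ) := norm_pos_iff.mpr hne
  have hA' : ContDiffAt ℝ 3 (fun z : (EuclideanSpace ℝ (Fin 3)) => A ‖z - x₀‖) x :=
    (hA.contDiffAt (Ioi_mem_nhds hpos)).comp x hn
  have hR' : ContDiffAt ℝ 3 (fun z : (EuclideanSpace ℝ (Fin 3)) => R ‖z - x₀‖) x :=
    (hR.contDiffAt (Ioi_mem_nhds hpos)).comp x hn
  rw [hfun]
  exact ((hA'.inner ℝ hsub).div hn (norm_ne_zero_iff.mpr hne)).add hR'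

/-- `∇T` is differentiable off the centre. [folklore] -/
theorem dipole_differentiableAt_gradient {T : (EuclideanSpace ℝ (Fin 3)) → ℝ} {x : (EuclideanSpace ℝ (Fin 3))} (h : ContDiffAt ℝ 3 T x) :
    DifferentiableAt ℝ (gradient T) x := by
  have hd : DifferentiableAt ℝ (fderiv ℝ T) x :=
    (h.fderiv_right (m := 2) (by norm_num)).differentiableAt (by norm_num)
  have hfun : gradient T = fun z => (InnerProductSpace.toDual ℝ (EuclideanSpace ℝ (Fin 3))).symm (fderiv ℝ T z) := rfl
  rw [hfun]
  exact (InnerProductSpace.toDual ℝ (EuclideanSpace ℝ (Fin 3))).symm.toContinuousLinearEquiv.toContinuousLinearMap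
    |>.differentiableAt.comp x hd

/-- `ΔT` is differentiable at a point where `T` is `C³`. [folklore] -/
theorem dipole_differentiableAt_laplacian {T : (EuclideanSpace ℝ (Fin 3)) → ℝ} {x : (EuclideanSpace ℝ (Fin 3))} (h : ContDiffAt ℝ 3 T x) :
    DifferentiableAt ℝ (Δ T) x := by
  have h2 : ContDiffAt ℝ 1 (iteratedFDeriv ℝ 2 T) x := h.iteratedFDeriv_right (by norm_num)
  have hd : DifferentiableAt ℝ (iteratedFDeriv ℝ 2 T) x := h2.differentiableAt one_ne_zero
  rw [laplacian_eq_iteratedFDeriv_orthonormalBasis T (stdOrthonormalBasis ℝ (EuclideanSpace ℝ (Fin 3)))]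
  refine DifferentiableAt.fun_sum fun i _ => ?_
  exact hd.continuousMultilinear_apply_const _


/-! ### Tangential derivatives of the dipole potential at the poles -/

/-- Along a line through `p ≠ x₀` in a direction `w ⊥ p − x₀`, the distance to `x₀` has zero derivative. [folklore] -/
theorem hasDerivAt_norm_line {x₀ p w : (EuclideanSpace ℝ (Fin 3))} (hp : p ≠ x₀) (hw : ⟪p - x₀, w⟫ = 0) :
    HasDerivAt (fun t : ℝ => ‖p + t • w - x₀‖) 0 0 := by
  have hℓ : HasDerivAt (fun t : ℝ => p + t • w - x₀) w 0 := by
    have h := (((hasDerivAt_id' (0 : ℝ)).smul_const w).const_add p).sub_const x₀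
    simpa only [one_smul] using h
  have hsq := hℓ.norm_sq
  have hne : ‖p + (0 : ℝ) • w - x₀‖ ^ 2 ≠ 0 := by
    rw [zero_smul, add_zero]
    exact pow_ne_zero 2 (norm_ne_zero_iff.mpr (sub_ne_zero.mpr hp))
  have h := hsq.sqrt hne
  have hfun : (fun t : ℝ => Real.sqrt (‖p + t • w - x₀‖ ^ 2)) = fun t => ‖p + t • w - x₀‖ :=
    funext fun t => Real.sqrt_sq (norm_nonneg _)
  rw [hfun] at h
  refine h.congr_deriv ?_
  rw [zero_smul, add_zero, hw]
  simp

/-- **Tangential derivative at a pole.**  For the dipole potential `T` (with `A, R ∈ C³(0,∞)`), at a point `p ≠ x₀` and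
a direction `w` orthogonal to `p − x₀` and to `A(‖p − x₀‖)`, the derivative `DT(p)[w]` vanishes (at the poles
`p = x₀ ± r·Â(r)` every tangent direction is such a `w`). [folklore] -/
theorem dipole_fderiv_apply_eq_zero {A : ℝ → (EuclideanSpace ℝ (Fin 3))} {R : ℝ → ℝ} {x₀ p w : (EuclideanSpace ℝ (Fin 3))} {T : (EuclideanSpace ℝ (Fin 3)) → ℝ}
    (hT : ∀ z, T z = ⟪A ‖z - x₀‖, z - x₀⟫ / ‖z - x₀‖ + R ‖z - x₀‖)
    (hA : ContDiffOn ℝ 3 A (Ioi 0)) (hR : ContDiffOn ℝ 3 R (Ioi 0)) (hp : p ≠ x₀)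
    (hw : ⟪p - x₀, w⟫ = 0) (hAw : ⟪A ‖p - x₀‖, w⟫ = 0) :
    fderiv ℝ T p w = 0 := by
  have hne : p - x₀ ≠ 0 := sub_ne_zero.mpr hp
  have hpos : ‖p - x₀‖ ∈ Ioi (0 : ℝ) := norm_pos_iff.mpr hne
  -- the line `t ↦ p + t w`
  have hℓ : HasDerivAt (fun t : ℝ => p + t • w) w 0 := by
    have h := ((hasDerivAt_id' (0 : ℝ)).smul_const w).const_add p
    simpa only [one_smul] using h
  have hℓ' : HasDerivAt (fun t : ℝ => p + t • w - x₀) w 0 := hℓ.sub_const x₀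
  have h0 : p + (0 : ℝ) • w = p := by rw [zero_smul, add_zero]
  -- `DT(p)[w]` is the derivative of `T` along the line
  have hTd : DifferentiableAt ℝ T p := (dipole_contDiffAt hT hA hR hp).differentiableAt (by norm_num)
  have hcomp : HasDerivAt (fun t : ℝ => T (p + t • w)) (fderiv ℝ T p w) 0 := by
    have hF : HasFDerivAt T (fderiv ℝ T p) (p + (0 : ℝ) • w) := by rw [h0]; exact hTd.hasFDerivAt
    exact hF.comp_hasDerivAt (0 : ℝ) hℓ
  -- the explicit derivative along the line
  have hN : HasDerivAt (fun t : ℝ => ‖p + t • w - x₀‖) 0 0 := hasDerivAt_norm_line hp hw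
  have hAd : HasDerivAt A (deriv A ‖p + (0 : ℝ) • w - x₀‖) ‖p + (0 : ℝ) • w - x₀‖ := by
    rw [h0]
    exact ((hA.differentiableOn (by norm_num)).differentiableAt (Ioi_mem_nhds hpos)).hasDerivAt
  have hRd : HasDerivAt R (deriv R ‖p + (0 : ℝ) • w - x₀‖) ‖p + (0 : ℝ) • w - x₀‖ := by
    rw [h0]
    exact ((hR.differentiableOn (by norm_num)).differentiableAt (Ioi_mem_nhds hpos)).hasDerivAt
  have hAN : HasDerivAt (fun t : ℝ => A ‖p + t • w - x₀‖) ((0 : ℝ) • deriv A ‖p + (0 : ℝ) • w - x₀‖) 0 :=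
    hAd.scomp (0 : ℝ) hN
  have hRN : HasDerivAt (fun t : ℝ => R ‖p + t • w - x₀‖) (deriv R ‖p + (0 : ℝ) • w - x₀‖ * 0) 0 :=
    hRd.comp (0 : ℝ) hN
  have hI := hAN.inner ℝ hℓ'
  have hN0 : ‖p + (0 : ℝ) • w - x₀‖ ≠ 0 := by rw [h0]; exact norm_ne_zero_iff.mpr hne
  have hexp := (hI.div hN hN0).add hRN
  have hfun : (fun t : ℝ => T (p + t • w)) =
      fun t => ⟪A ‖p + t • w - x₀‖, p + t • w - x₀⟫ / ‖p + t • w - x₀‖ + R ‖p + t • w - x₀‖ :=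
    funext fun t => hT _
  rw [hfun] at hcomp
  rw [hcomp.unique hexp]
  simp only [zero_smul, add_zero, inner_zero_left, mul_zero, sub_zero] 
  rw [hAw]
  simp


/-! ### One-variable calculus of the frame profiles `σ ↦ ⟪A(√σ), e⟫/√σ` -/

/-- The profile `h(ρ) = ⟪A ρ, e⟫/ρ` and its derivative on `(0,∞)`. [folklore] -/
theorem profile_hasDerivAt_rho {A : ℝ → (EuclideanSpace ℝ (Fin 3))} (hA : ContDiffOn ℝ 3 A (Ioi 0)) (e : (EuclideanSpace ℝ (Fin 3))) {ρ : ℝ} (hρ : 0 < ρ) :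
    HasDerivAt (fun s : ℝ => ⟪A s, e⟫ / s) ((⟪deriv A ρ, e⟫ * ρ - ⟪A ρ, e⟫) / ρ ^ 2) ρ := by
  have hAd : HasDerivAt A (deriv A ρ) ρ :=
    ((hA.differentiableOn (by norm_num)).differentiableAt (Ioi_mem_nhds hρ)).hasDerivAt
  have hI : HasDerivAt (fun s : ℝ => ⟪A s, e⟫) ⟪deriv A ρ, e⟫ ρ := by
    have h := hAd.inner ℝ (hasDerivAt_const ρ e)
    simpa only [inner_zero_right, zero_add] using h
  have h := hI.div (hasDerivAt_id' ρ) hρ.ne'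
  exact h.congr_deriv (by ring)

/-- **Frame-profile calculus.**  For `A ∈ C³(0,∞)`, a vector `e` and `r > 0`, the profile `P(σ) = ⟪A(√σ), e⟫/√σ` of
the fixed-axis potential `⟪e, y⟫·P(‖y‖²) = ⟪e, y⟫⟪A(‖y‖), e⟫/‖y‖` has the derivative data required by
`PointSource.laplacian_potential` at `σ = r²`, and `4r²P″(r²) + 10P′(r²) = (⟪A″,e⟫ + (2/r)⟪A′,e⟫ − (2/r²)⟪A,e⟫)(r)/r`
(the `σ = ρ² ↔ ρ` conversion). [folklore] -/
theorem profile_calculus {A : ℝ → (EuclideanSpace ℝ (Fin 3))} (hA : ContDiffOn ℝ 3 A (Ioi 0)) (e : (EuclideanSpace ℝ (Fin 3))) {r : ℝ} (hr : 0 < r) :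
    ∃ P₁ : ℝ → ℝ, ∃ p₂ : ℝ,
      (∀ σ ∈ Ioi (0 : ℝ), HasDerivAt (fun σ : ℝ => ⟪A (Real.sqrt σ), e⟫ / Real.sqrt σ) (P₁ σ) σ) ∧
      HasDerivAt P₁ p₂ (r ^ 2) ∧
      ContDiffAt ℝ 2 (fun σ : ℝ => ⟪A (Real.sqrt σ), e⟫ / Real.sqrt σ) (r ^ 2) ∧
      4 * r ^ 2 * p₂ + 10 * P₁ (r ^ 2) =
        (⟪iteratedDeriv 2 A r, e⟫ + 2 / r * ⟪deriv A r, e⟫ - 2 / r ^ 2 * ⟪A r, e⟫) / r := by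
  -- the profile in the variable `ρ`: `h(ρ) = ⟪A ρ, e⟫/ρ`, `h₁ = h′`, and `k = h₁/(2ρ)` so that `P′(σ) = k(√σ)`
  set k : ℝ → ℝ := fun ρ => (⟪deriv A ρ, e⟫ * ρ - ⟪A ρ, e⟫) / ρ ^ 2 * (1 / (2 * ρ)) with hk
  have hsq : Real.sqrt (r ^ 2) = r := Real.sqrt_sq hr.le
  have hr2 : (r ^ 2 : ℝ) ≠ 0 := pow_ne_zero 2 hr.ne'
  -- first derivative on `(0,∞)`
  have hP : ∀ σ ∈ Ioi (0 : ℝ),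
      HasDerivAt (fun σ : ℝ => ⟪A (Real.sqrt σ), e⟫ / Real.sqrt σ) (k (Real.sqrt σ)) σ := by
    intro σ hσ
    have hsσ : 0 < Real.sqrt σ := Real.sqrt_pos.mpr hσ
    have h1 := (profile_hasDerivAt_rho hA e hsσ).comp σ (Real.hasDerivAt_sqrt (ne_of_gt hσ))
    exact h1
  -- the derivative of `k` at `r`
  have hA2 : ContDiffAt ℝ 2 A r := (hA.of_le (by norm_num)).contDiffAt (Ioi_mem_nhds hr)
  have hAd : HasDerivAt A (deriv A r) r := (hA2.differentiableAt (by norm_num)).hasDerivAt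
  have hAdd : HasDerivAt (deriv A) (iteratedDeriv 2 A r) r := amplitude_hasDerivAt_deriv hA2
  have hnum : HasDerivAt (fun ρ : ℝ => ⟪deriv A ρ, e⟫ * ρ - ⟪A ρ, e⟫)
      (⟪iteratedDeriv 2 A r, e⟫ * r + ⟪deriv A r, e⟫ * 1 - ⟪deriv A r, e⟫) r := by
    have h1 : HasDerivAt (fun ρ : ℝ => ⟪deriv A ρ, e⟫) ⟪iteratedDeriv 2 A r, e⟫ r := by
      have h := hAdd.inner ℝ (hasDerivAt_const r e)
      simpa only [inner_zero_right, zero_add] using h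
    have h2 : HasDerivAt (fun ρ : ℝ => ⟪A ρ, e⟫) ⟪deriv A r, e⟫ r := by
      have h := hAd.inner ℝ (hasDerivAt_const r e)
      simpa only [inner_zero_right, zero_add] using h
    exact (h1.mul (hasDerivAt_id' r)).sub h2
  have hden : HasDerivAt (fun ρ : ℝ => ρ ^ 2) (2 * r) r := by
    simpa using hasDerivAt_pow 2 r
  have hhalf : HasDerivAt (fun ρ : ℝ => 1 / (2 * ρ)) ((0 * (2 * r) - 1 * (2 * 1)) / (2 * r) ^ 2) r :=
    (hasDerivAt_const r (1 : ℝ)).div ((hasDerivAt_id' r).const_mul 2) (by positivity)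
  have hkd := ((hnum.div hden hr2).mul hhalf)
  -- transport to the variable `σ` at `σ = r²`
  have hkd' : HasDerivAt k
      ((( ⟪iteratedDeriv 2 A r, e⟫ * r + ⟪deriv A r, e⟫ * 1 - ⟪deriv A r, e⟫) * r ^ 2
          - (⟪deriv A r, e⟫ * r - ⟪A r, e⟫) * (2 * r)) / (r ^ 2) ^ 2 * (1 / (2 * r))
        + (⟪deriv A r, e⟫ * r - ⟪A r, e⟫) / r ^ 2 * ((0 * (2 * r) - 1 * (2 * 1)) / (2 * r) ^ 2))
      (Real.sqrt (r ^ 2)) := by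
    rw [hsq]; exact hkd
  have hP₁ := hkd'.comp (r ^ 2) (Real.hasDerivAt_sqrt hr2)
  refine ⟨fun σ => k (Real.sqrt σ), _, hP, hP₁, ?_, ?_⟩
  · -- `C²` (indeed `C³`) at `r²`
    have hs : ContDiffAt ℝ 2 Real.sqrt (r ^ 2) := Real.contDiffAt_sqrt hr2
    have hAs : ContDiffAt ℝ 2 (fun σ => A (Real.sqrt σ)) (r ^ 2) := by
      have hA2' : ContDiffAt ℝ 2 A (Real.sqrt (r ^ 2)) := by rw [hsq]; exact hA2
      exact hA2'.comp (r ^ 2) hs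
    have hne : Real.sqrt (r ^ 2) ≠ 0 := by rw [hsq]; exact hr.ne'
    exact (hAs.inner ℝ contDiffAt_const).div hs hne
  · -- the value `4r²p₂ + 10P′(r²)`
    simp only [hk, hsq]
    field_simp
    ring


/-- Radial-profile calculus for `σ ↦ R(√σ)`, `R ∈ C³(0,∞)`: the derivative data required by
`laplacian_comp_norm_sq` at `σ = r²`. [folklore] -/
theorem radial_calculus {R : ℝ → ℝ} (hR : ContDiffOn ℝ 3 R (Ioi 0)) {r : ℝ} (hr : 0 < r) :
    ∃ g₁ : ℝ → ℝ, ∃ g₂ : ℝ,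
      (∀ σ ∈ Ioi (0 : ℝ), HasDerivAt (fun σ : ℝ => R (Real.sqrt σ)) (g₁ σ) σ) ∧
      HasDerivAt g₁ g₂ (r ^ 2) ∧ ContDiffAt ℝ 2 (fun σ : ℝ => R (Real.sqrt σ)) (r ^ 2) := by
  set k : ℝ → ℝ := fun ρ => deriv R ρ * (1 / (2 * ρ)) with hk
  have hsq : Real.sqrt (r ^ 2) = r := Real.sqrt_sq hr.le
  have hr2 : (r ^ 2 : ℝ) ≠ 0 := pow_ne_zero 2 hr.ne'
  have hP : ∀ σ ∈ Ioi (0 : ℝ), HasDerivAt (fun σ : ℝ => R (Real.sqrt σ)) (k (Real.sqrt σ)) σ := by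
    intro σ hσ
    have hsσ : 0 < Real.sqrt σ := Real.sqrt_pos.mpr hσ
    have hRd : HasDerivAt R (deriv R (Real.sqrt σ)) (Real.sqrt σ) :=
      ((hR.differentiableOn (by norm_num)).differentiableAt (Ioi_mem_nhds hsσ)).hasDerivAt
    exact hRd.comp σ (Real.hasDerivAt_sqrt (ne_of_gt hσ))
  have hR2 : ContDiffAt ℝ 2 R r := (hR.of_le (by norm_num)).contDiffAt (Ioi_mem_nhds hr)
  have hRdd : HasDerivAt (deriv R) (iteratedDeriv 2 R r) r := amplitude_hasDerivAt_deriv hR2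
  have hhalf : HasDerivAt (fun ρ : ℝ => 1 / (2 * ρ)) ((0 * (2 * r) - 1 * (2 * 1)) / (2 * r) ^ 2) r :=
    (hasDerivAt_const r (1 : ℝ)).div ((hasDerivAt_id' r).const_mul 2) (by positivity)
  have hkd : HasDerivAt k
      (iteratedDeriv 2 R r * (1 / (2 * r)) + deriv R r * ((0 * (2 * r) - 1 * (2 * 1)) / (2 * r) ^ 2))
      (Real.sqrt (r ^ 2)) := by
    rw [hsq]; exact hRdd.mul hhalf
  refine ⟨fun σ => k (Real.sqrt σ), _, hP, hkd.comp (r ^ 2) (Real.hasDerivAt_sqrt hr2), ?_⟩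
  have hs : ContDiffAt ℝ 2 Real.sqrt (r ^ 2) := Real.contDiffAt_sqrt hr2
  have hR2' : ContDiffAt ℝ 2 R (Real.sqrt (r ^ 2)) := by rw [hsq]; exact hR2
  exact hR2'.comp (r ^ 2) hs

/-! ### The Laplacian of the dipole potential on a sphere, in an orthonormal frame -/

/-- Expansion of the dipole potential in an orthonormal frame `b`: a sum of three FIXED-axis potentials
`⟪bᵢ, y⟫·Pᵢ(‖y‖²)`, `Pᵢ(σ) = ⟪A(√σ), bᵢ⟫/√σ`, plus the radial part `R(√(‖y‖²))`. [folklore] -/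
theorem dipole_frame_expansion {A : ℝ → (EuclideanSpace ℝ (Fin 3))} {R : ℝ → ℝ} {x₀ : (EuclideanSpace ℝ (Fin 3))} {T : (EuclideanSpace ℝ (Fin 3)) → ℝ}
    (hT : ∀ z, T z = ⟪A ‖z - x₀‖, z - x₀⟫ / ‖z - x₀‖ + R ‖z - x₀‖) (b : OrthonormalBasis (Fin 3) ℝ (EuclideanSpace ℝ (Fin 3)))
    (y : (EuclideanSpace ℝ (Fin 3))) :
    T (x₀ + y) = (∑ i, ⟪b i, y⟫ * (⟪A (Real.sqrt (‖y‖ ^ 2)), b i⟫ / Real.sqrt (‖y‖ ^ 2)))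
      + R (Real.sqrt (‖y‖ ^ 2)) := by
  have hs : Real.sqrt (‖y‖ ^ 2) = ‖y‖ := Real.sqrt_sq (norm_nonneg _)
  rw [hT, add_sub_cancel_left, hs, ← b.sum_inner_mul_inner (A ‖y‖) y, Finset.sum_div]
  congr 1
  refine Finset.sum_congr rfl fun i _ => ?_
  ring

/-- **The Laplacian of the dipole potential on the sphere `S_r(x₀)`** in an orthonormal frame `b`:
`ΔT(x₀ + y) = Σᵢ ⟪bᵢ, y⟫·Cᵢ + D` for `‖y‖ = r`, with `Cᵢ = (⟪A″, bᵢ⟫ + (2/r)⟪A′, bᵢ⟫ − (2/r²)⟪A, bᵢ⟫)(r)/r` and a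
constant `D` (the radial part).  (`PointSource.laplacian_potential` per frame vector + `laplacian_comp_norm_sq`.)
[folklore] -/
theorem dipole_laplacian_sphere {A : ℝ → (EuclideanSpace ℝ (Fin 3))} {R : ℝ → ℝ} {x₀ : (EuclideanSpace ℝ (Fin 3))} {T : (EuclideanSpace ℝ (Fin 3)) → ℝ}
    (hT : ∀ z, T z = ⟪A ‖z - x₀‖, z - x₀⟫ / ‖z - x₀‖ + R ‖z - x₀‖)
    (hA : ContDiffOn ℝ 3 A (Ioi 0)) (hR : ContDiffOn ℝ 3 R (Ioi 0)) (b : OrthonormalBasis (Fin 3) ℝ (EuclideanSpace ℝ (Fin 3)))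
    {r : ℝ} (hr : 0 < r) :
    ∃ C : Fin 3 → ℝ, ∃ D : ℝ,
      (∀ i, C i = (⟪iteratedDeriv 2 A r, b i⟫ + 2 / r * ⟪deriv A r, b i⟫ - 2 / r ^ 2 * ⟪A r, b i⟫) / r) ∧
      ∀ y : (EuclideanSpace ℝ (Fin 3)), ‖y‖ = r → (Δ T) (x₀ + y) = (∑ i, ⟪b i, y⟫ * C i) + D := by
  choose P₁ p₂ hP hP₁ hP2 hval using fun i : Fin 3 => profile_calculus hA (b i) hr
  obtain ⟨g₁, g₂, hg, hg₁, hg2⟩ := radial_calculus hR hr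
  refine ⟨fun i => 4 * r ^ 2 * p₂ i + 10 * P₁ i (r ^ 2),
    4 * g₂ * r ^ 2 + 2 * (Module.finrank ℝ (EuclideanSpace ℝ (Fin 3))) * g₁ (r ^ 2), fun i => hval i, ?_⟩
  intro y hy
  have hy0 : y ≠ 0 := by rw [← norm_ne_zero_iff, hy]; exact hr.ne'
  have hy2 : ‖y‖ ^ 2 = r ^ 2 := by rw [hy]
  have hyU : ‖y‖ ^ 2 ∈ Ioi (0 : ℝ) := by rw [hy2]; exact pow_pos hr 2
  -- the summands, as functions
  set t : Fin 3 → (EuclideanSpace ℝ (Fin 3)) → ℝ := fun i z => ⟪b i, z⟫ * (⟪A (Real.sqrt (‖z‖ ^ 2)), b i⟫ / Real.sqrt (‖z‖ ^ 2))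
    with ht
  set rad : (EuclideanSpace ℝ (Fin 3)) → ℝ := fun z => R (Real.sqrt (‖z‖ ^ 2)) with hrad
  -- translate to the centre and expand in the frame
  have hTS : T = fun x => (t 0 + t 1 + t 2 + rad) (x - x₀) := by
    funext x
    have h := dipole_frame_expansion hT b (x - x₀)
    rw [add_sub_cancel] at h
    rw [h]
    simp only [ht, hrad, Fin.sum_univ_three, Pi.add_apply]
  have h1 : (Δ T) (x₀ + y) = (Δ (t 0 + t 1 + t 2 + rad)) y := by
    rw [hTS, Literature.Analysis.PDE.LoewnerNirenberg.laplacian_translate_sub _ x₀ (x₀ + y),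
      add_sub_cancel_left]
  -- `C²` regularity of the summands at `y`
  have hti : ∀ i, ContDiffAt ℝ 2 (t i) y := fun i => by
    have h2 : ContDiffAt ℝ 2 (fun σ : ℝ => ⟪A (Real.sqrt σ), b i⟫ / Real.sqrt σ) (‖y‖ ^ 2) := by
      rw [hy2]; exact hP2 i
    have h3 : ContDiffAt ℝ 2 (fun z : (EuclideanSpace ℝ (Fin 3)) => ⟪A (Real.sqrt (‖z‖ ^ 2)), b i⟫ / Real.sqrt (‖z‖ ^ 2)) y :=
      ContDiffAt.comp (g := fun σ : ℝ => ⟪A (Real.sqrt σ), b i⟫ / Real.sqrt σ) (f := fun z : (EuclideanSpace ℝ (Fin 3)) => ‖z‖ ^ 2) y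
        h2 (contDiff_norm_sq ℝ).contDiffAt
    exact (innerSL ℝ (b i) : (EuclideanSpace ℝ (Fin 3)) →L[ℝ] ℝ).contDiff.contDiffAt.mul h3
  have hradC : ContDiffAt ℝ 2 rad y := by
    have h2 : ContDiffAt ℝ 2 (fun σ : ℝ => R (Real.sqrt σ)) (‖y‖ ^ 2) := by rw [hy2]; exact hg2
    exact ContDiffAt.comp (g := fun σ : ℝ => R (Real.sqrt σ)) (f := fun z : (EuclideanSpace ℝ (Fin 3)) => ‖z‖ ^ 2) y
      h2 (contDiff_norm_sq ℝ).contDiffAt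
  -- the Laplacians of the summands
  have hΔt : ∀ i, (Δ (t i)) y = ⟪b i, y⟫ * (4 * r ^ 2 * p₂ i + 10 * P₁ i (r ^ 2)) := fun i => by
    have hP₁' : HasDerivAt (P₁ i) (p₂ i) (‖y‖ ^ 2) := by rw [hy2]; exact hP₁ i
    have hP2' : ContDiffAt ℝ 2 (fun σ : ℝ => ⟪A (Real.sqrt σ), b i⟫ / Real.sqrt σ) (‖y‖ ^ 2) := by
      rw [hy2]; exact hP2 i
    have h := KinematicShadow.PointSource.laplacian_potential (e := b i) isOpen_Ioi hyU (hP i) hP₁' hP2'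
    rw [hy2] at h
    exact h
  have hΔrad : (Δ rad) y = 4 * g₂ * r ^ 2 + 2 * (Module.finrank ℝ (EuclideanSpace ℝ (Fin 3))) * g₁ (r ^ 2) := by
    have hg₁' : HasDerivAt g₁ g₂ (‖y‖ ^ 2) := by rw [hy2]; exact hg₁
    have h := laplacian_comp_norm_sq isOpen_Ioi hg hyU hg₁'
    rw [hy2] at h
    exact h
  have h01 : ContDiffAt ℝ 2 (t 0 + t 1) y := (hti 0).add (hti 1)
  have h012 : ContDiffAt ℝ 2 (t 0 + t 1 + t 2) y := h01.add (hti 2)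
  rw [h1, h012.laplacian_add hradC, h01.laplacian_add (hti 2), (hti 0).laplacian_add (hti 1),
    hΔt 0, hΔt 1, hΔt 2, hΔrad, Fin.sum_univ_three]

end Summit.NavierStokesRegularity.NavierStokesRegularity.Theorems.PoloidalLiouville.FluxStarvedDipole

end
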